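import Summits.QuantumFields.YangMills.Theorems.BalabanUVNodesN09HregSelOfThm1OfNumerics
import Summits.QuantumFields.YangMills.Theorems.BalabanUVNodesN09TransportPositiveOfLocalRoute
import Summits.QuantumFields.YangMills.Theorems.BalabanUVNodesN09FibreIntegralContinuousOfChartRegularity
import HarnessLib

/-!
# BalabanUVNodes ∕ N09 — THE REGULARITY TOWER ON THE LOCAL ROUTE FOR THE OFFER (`UkSel` ∕ `critCfgSelOfRecord` ∕ `chiFixed29Sel` over `TcanOfRecord`): by induction on the step,
# `A_j` continuous on every `domAlt_j`, `hreg_j` and (F3)_j for all `j < K` — from [B11] Thm 1's two-radii binders and NUMERICS ONLY (no hcrit, no (H-U), no (I19), no `A_j` displayed)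

Cell `pub-ymgap`, width seat `pub-ymgap-dag-n09-w2` generation 5 (HUMAN RULING D-0149; DAG node N09 = [Balaban1987RG1] §§2–5; INBOX CLAIM-3∕INTENT-7 l.39169).
`--kind proof --supports stmt-QuantumFields-27364 --as helper` (K1⁹ `StabilityBRunRowsAtRecordR13SepCoPHV`; count-neutral; theorems only, 0 def ∕ 0 instance ∕ 0 notation ∕ 0 sorry).

WHY.  dag-n09-w3 g6's capstone `…N09HregSelOfThm1OfNumerics.hregSel_of_thm1_of_numerics` closes ONE STEP of road B for the OFFER objects: `hreg_k` for the Sel β-input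
`ρ_k = χ^{(2.9),Sel}_k·exp[−GF_k∕g_k² + A_k]` over `TcanOfRecord` from [B11] Thm 1's two-radii binders `h11`∕`hreg8` (N07), numerics, AND the step's displayed input
`hA : ContinuousOn A_k domAlt_k`.  That last input is the previous step's OUTPUT once (F3)_k is available — which this seat's `…N09TransportPositiveOfLocalRoute` (p637228) supplies from
LOCAL data at the witness `V^{(k),Sel}(V)`: it lies in the fibre over `V` (`avg_critCfgSelOfRecord`), every fluctuation variable vanishes there so `χ^{(2.9),Sel}_k = 1` and `ρ_k > 0`, it
lies in the interior of the local support set (w3 g6's `hρK_betaInput_chi29Sel_of_hsolν_of_numerics`) hence in the loop guard and in `domAlt_k`, and `ρ_k` is continuous at it (w3 g6's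
`hρc_betaInput_chi29Sel_local_of_continuousOn_crit` fed by dag-n09-w1 g6's continuous selector).  With dag-n09-w1 g5's corner and base the induction runs, and NOTHING but [B11]'s
two-radii binders and numerics stays displayed: road B's regularity tower is CLOSED FOR THE OFFER.

WHAT IS PROVED (theorems only; torus `K`, numerics `ν`, radius `εbg`, history `g`, threshold `ε₁`).
§1 `betaInput_chi29Sel_critCfgSel_pos` (the witness carries positive density), ★★ `hregSel_pos_contA_of_thm1_of_numerics` (THE STEP: IH `ContinuousOn A_k domAlt_k` ⟹ `hreg_k` ∧ (F3)_k ∧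
   `ContinuousOn A_{k+1} domAlt_{k+1}`), ★★★ `continuousOn_effActionHT_chi29Sel_all_of_thm1_of_numerics` (THE TOWER, `∀ j ≤ K`), ★★★ `hregSel_pos_all_of_thm1_of_numerics`
   (`∀ j < K`: `hreg_j` ∧ `HasContTransportOn` ∧ (F3)_j), ★★ `normConst_chi29Sel_pos_and_eq_exp_of_thm1_of_numerics` (`𝐍_j > 0` and (0.19) `T_jρ_j = 𝐍_j·e^{A_{j+1}}` on every domain).
§2 `eventually_nhdsGT_lt_of_continuous` ∕ `eventually_nhdsGT_le_of_continuous` (bookkeeping), ★ `towerSel_numerics_inhabited` (the twenty numerics letters are JOINTLY INHABITED for every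
   torus family ∕ `N ≥ 1` ∕ `K`), ★★ `exists_numerics_hregSel_pos_all_of_thm1` (for SOME numerics the only displayed inputs left are [B11]'s two-radii binders — non-vacuity, NOT the record's row).
§3 ★★ `hregSel_pos_all_of_thm1_of_numerics_alphaFree` (α-FREE EDITION in road A′'s currency, dag-n09-w4 g6: at `α := (((d+2)L)²∕4)·ε₀` the four guard letters are theorems of the
   three `ε₀`-lines `h24 h64 hL` and the strict (hord)).

DISPLAYED (never asserted): [B11] Thm 1 at two radii on the domains — `h11` (existence + orbit uniqueness at `εbg`) and `hreg8` ((8)-membership at `εreg`) — N07's; NUMERICS (`0 < ε₁`; the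
loop guard `α ≤ 1∕24`, `α < δ_N`, `157α < L^{1−d}` with `(ℓ²∕4)·B < α`; [B7] on `εreg`; the rider's two; STRICT `B < ε₀`; `εreg < εbg`, `εreg < α₀` with [B7]∕guard numerics on `α₀`;
`0 ≤ ε₀` resp. `0 < ε₀`, `((dL)²∕4)·ε₀ < δ_Fed`) — jointly inhabited by SOME numerics (§2); whether the RECORD's numerics row meets them is the K0-numerics lane's knit, not claimed here.

HONEST FRAMING.  Composition BY NAME for the OFFER objects, which NO record reads (adoption = def-T ∕ def-B); NOTHING of Bałaban's asserted; `hreg`∕(F3)∕`contTOn` AT THE RECORD (bare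
`Uk`) NOT discharged — there the identical tower (this seat's `…N09RegularityTowerOfLocalRoute`) displays in addition on-domain hcrit + (H-U) + (I19); N09 NOT discharged; conjunct 1 (Lemma 4) ∕
FLAG №7 untouched; K0⁷ ∕ K1⁹ ∕ K2⁹ ∕ K3⁸ NOT closed; counts unmoved (typed 28∕28 · discharged 5∕28); no summit statement is proved here; R4 = the conditional finite-𝕋⁴ rung
`BalabanLadder.UV` only — NOT continuum ∕ ℝ⁴ ∕ OS; the Yang–Mills mass gap (Clay) is NOT proved by any of this.
-/

noncomputable section

open Filter Topology Set Function MeasureTheory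

namespace Summit.QuantumFields.YangMills.BalabanUVNodes.N09RegularityTowerSelOfThm1OfNumerics

open Literature.MathematicalPhysics.QuantumFieldTheory.Balaban1983to89
open Literature.MathematicalPhysics.QuantumFieldTheory.Balaban1983to89.Node00
open Literature.MathematicalPhysics.QuantumFieldTheory.Balaban1983to89.T4Continuum (T4Family)
open Literature.MathematicalPhysics.QuantumFieldTheory.Balaban1983to89.BlockAveraging (Small Idx loopHol)
open Literature.MathematicalPhysics.QuantumFieldTheory.Balaban1983to89.BlockAveragingHaarAC (centralBond)
open Literature.MathematicalPhysics.QuantumFieldTheory.Balaban1983to89.ExpMeanLog (expMeanLogSU deltaSU deltaSU_pos)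
open Literature.MathematicalPhysics.QuantumFieldTheory.Balaban1983to89.FederbushMean (deltaFed deltaFed_pos)
open Literature.MathematicalPhysics.QuantumFieldTheory.Balaban1983to89.B12Eq019ActionBody (normConst_mul_exp_nextAction)
open Literature.MathematicalPhysics.QuantumFieldTheory.Balaban1983to89.B12ContinuousTransportInvarianceOn (isOpen_domAltOfRecord)
open Summit.QuantumFields.YangMills.BalabanUVNodes.N09HregSelOfThm1OfNumerics (betaInput_chi29Sel_nonneg localSupportSet_subset_domAlt_of_lt hregSel_of_thm1_of_numerics)
open Summit.QuantumFields.YangMills.BalabanUVNodes.N09LocalSupportSetAtRecord (localSupportSet_subset_loopGuard)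
open Summit.QuantumFields.YangMills.BalabanUVNodes.N09LocalSupportSetAnyCrit (hρK_betaInput_chi29Sel_of_hsolν_of_numerics)
open Summit.QuantumFields.YangMills.BalabanUVNodes.N09DensityContinuousOffThresholdsAnyCrit (hρc_betaInput_chi29Sel_local_of_continuousOn_crit)
open Summit.QuantumFields.YangMills.BalabanUVNodes.N09BetaInputMeasurableOverTcan (measurable_betaInput_TcanOfRecord_chi29Sel)
open Summit.QuantumFields.YangMills.BalabanUVNodes.N09SelectorContinuousOfThm1TwoRadii (hcritSel_domAlt_of_thm1_εbg_of_reg8)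
open Summit.QuantumFields.YangMills.BalabanUVNodes.N09BackgroundRadiiTransfer (ukExists_εreg_of_h11_of_reg8)
open Summit.QuantumFields.YangMills.BalabanUVNodes.N09GaugeFixingTermContinuousOnAdmissible (continuousOn_gfOfRecord_domAlt)
open Summit.QuantumFields.YangMills.BalabanUVNodes.N09TransportPositiveOnDomainOfFibredChart (continuousOn_effActionHT_succ_of_subset_regSetOfRecord_of_pos)
open Summit.QuantumFields.YangMills.BalabanUVNodes.N09FibreIntegralContinuousOfChartRegularity (continuousOn_effActionHT_zero)
open Summit.QuantumFields.YangMills.BalabanUVNodes.N09TransportPositiveOfLocalRoute (TcanOfRecord_pos_of_localRoute_of_avg_eq)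

variable {F : T4Family} {N : ℕ} [NeZero N]

section Tower

variable (ν : Stage7Numerics) (εbg : ℝ) (K : ℕ) (g : ℕ → ℝ) {ε₁ : ℝ}

/-- **THE WITNESS CARRIES POSITIVE DENSITY**: for `k + 1 ≤ m + K`, `V` solvable at `εreg` and `0 < ε₁`, every fluctuation variable of `V^{(k),Sel}(V)` vanishes (it lies in the fibre over `V`,
`avg_critCfgSelOfRecord`), so `χ^{(2.9),Sel}_k = 1` there and `ρ_k(V^{(k),Sel}(V)) > 0` (any transport `T`). [cite: Balaban1987RG1, (2.3) p.265, (2.9) p.266 and (0.19) p.255] -/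
theorem betaInput_chi29Sel_critCfgSel_pos (hε1 : 0 < ε₁) (T : Transport F N) {k : ℕ} (hk1 : k + 1 ≤ (F.P K).m + (F.P K).K)
    {V : GaugeField (F.P K) (k + 1) (SU N)} (hsol : UkExists F N K (k + 1) ν.εreg V) :
    (∀ b : PBond (F.P K) k, fluctDevSelOfRecord F N ν K k (critCfgSelOfRecord F N ν K k V) b = 0) ∧
      0 < betaInputOfRecord F N T (chiFixed29Sel F N ν ε₁) K g k (critCfgSelOfRecord F N ν K k V) := by
  have h0 : ∀ b : PBond (F.P K) k, fluctDevSelOfRecord F N ν K k (critCfgSelOfRecord F N ν K k V) b = 0 := fun b => by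
    rw [fluctDevSelOfRecord_apply, avg_critCfgSelOfRecord hk1 hsol, inv_mul_cancel, GaugeGroup.dist1_one]
  have hχ : chiFix29SelOfRecord F N ν ε₁ K k (critCfgSelOfRecord F N ν K k V) = 1 :=
    (chiFix29SelOfRecord_eq_one_iff ν ε₁ K k _).2 fun b _ => by rw [h0 b]; exact hε1
  have e : betaInputOfRecord F N T (chiFixed29Sel F N ν ε₁) K g k (critCfgSelOfRecord F N ν K k V) =
      chiFix29SelOfRecord F N ν ε₁ K k (critCfgSelOfRecord F N ν K k V) *
        Real.exp (-(1 / (g k) ^ 2) * gfOfRecord F N K k (critCfgSelOfRecord F N ν K k V) +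
          effActionHT F N T (chiFixed29Sel F N ν ε₁) K g k (critCfgSelOfRecord F N ν K k V)) := rfl
  refine ⟨h0, ?_⟩
  rw [e, hχ, one_mul]
  exact Real.exp_pos _

/-- ★★ **THE STEP ON THE LOCAL ROUTE FOR THE OFFER** (`T = TcanOfRecord`, `χ = chiFixed29Sel ν ε₁`, `k < K`): from the induction hypothesis `ContinuousOn A_k domAlt_k`, [B11] Thm 1's two-radii
binders and numerics — **`hreg_k` ∧ `HasContTransportOn`** (dag-n09-w3 g6's `hregSel_of_thm1_of_numerics`), **(F3)_k** (this seat's `TcanOfRecord_pos_of_localRoute_of_avg_eq` at the witness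
`V^{(k),Sel}(V)`), and **`ContinuousOn A_{k+1} domAlt_{k+1}`** (dag-n09-w1 g5's corner). [cite: Balaban1987RG1, (0.19) p.255, p.259, (2.3) p.265, (2.9) p.266 and (2.10) p.267; Balaban1985Variational, Thm 1 (8) p.279] -/
theorem hregSel_pos_contA_of_thm1_of_numerics {k : ℕ} (hk : k < K)
    (hε1 : 0 < ε₁) {α : ℝ} (hα24 : α ≤ 1 / 24) (hαδ : α < deltaSU (Fin N)) (hαL : 157 * α < (((F.P K).L : ℝ) ^ ((F.P K).d - 1))⁻¹)
    (hεreg : 0 < ν.εreg)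
    (hε3 : (143 * (((((F.P K).d + 4 : ℕ) : ℝ)) ^ 2 / 4) ^ 2) * ν.εreg ≤ 1 / 3)
    (hε2 : 2 * ν.εreg ≤ 2 * deltaSU (Fin N) / ((((F.P K).d + 4) * (F.P K).L : ℕ) : ℝ) ^ 2)
    (hn1 : 1640 * (2 * (((((F.P K).d + 2) * (F.P K).L : ℕ) : ℝ) * ε₁) + ((((F.P K).d + 2) * (F.P K).L : ℕ) : ℝ) ^ 2 / 4 * (2 * ν.εreg / ((F.P K).L : ℝ) ^ 2)) *
      (((F.P K).L : ℝ) ^ ((F.P K).d - 1)) ^ 2 ≤ 1)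
    (hn2 : 13 * (2 * (((((F.P K).d + 2) * (F.P K).L : ℕ) : ℝ) * ε₁) + ((((F.P K).d + 2) * (F.P K).L : ℕ) : ℝ) ^ 2 / 4 * (2 * ν.εreg / ((F.P K).L : ℝ) ^ 2)) *
      ((F.P K).L : ℝ) ^ ((F.P K).d - 1) < deltaSU (Fin N))
    (hαB : ((((F.P K).d + 2) * (F.P K).L : ℕ) : ℝ) ^ 2 / 4 *
      (2 * ν.εreg / ((F.P K).L : ℝ) ^ 2 + 4 * max ε₁ (10 * (((((F.P K).d + 2) * (F.P K).L : ℕ) : ℝ) * ε₁) * ((F.P K).L : ℝ) ^ ((F.P K).d - 1))) < α)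
    (hord : 2 * ν.εreg / ((F.P K).L : ℝ) ^ 2 + 4 * max ε₁ (10 * (((((F.P K).d + 2) * (F.P K).L : ℕ) : ℝ) * ε₁) * ((F.P K).L : ℝ) ^ ((F.P K).d - 1)) < ν.ε₀)
    {α₀ : ℝ} (hlt : ν.εreg < εbg) (he : ν.εreg < α₀) (hα0 : 0 < α₀)
    (hα3 : (143 * (((((F.P K).d + 4 : ℕ) : ℝ)) ^ 2 / 4) ^ 2) * α₀ ≤ 1 / 3)
    (hα2 : 2 * α₀ ≤ 2 * deltaSU (Fin N) / ((((F.P K).d + 4) * (F.P K).L : ℕ) : ℝ) ^ 2)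
    (hα24' : ((((F.P K).d + 2) * (F.P K).L : ℕ) : ℝ) ^ 2 / 4 * (2 * α₀) ≤ 1 / 24)
    (hαL' : 157 * (((((F.P K).d + 2) * (F.P K).L : ℕ) : ℝ) ^ 2 / 4 * (2 * α₀)) < (((F.P K).L : ℝ) ^ ((F.P K).d - 1))⁻¹)
    (hε₀ : 0 ≤ ν.ε₀) (hGFnum : ((((F.P K).d * (F.P K).L : ℕ) : ℝ)) ^ 2 / 4 * ν.ε₀ < deltaFed (Fin N))
    (h11 : ∀ j, j ≤ K → ∀ V ∈ domAltOfRecord F N ν K j, UkExists F N K j εbg V ∧ UniqueUkOrbit F N K j εbg V)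
    (hreg8 : ∀ j, j ≤ K → ∀ V ∈ domAltOfRecord F N ν K j, Uk F N K j εbg V ∈ bgReg F N K j ν.εreg)
    (hA : ContinuousOn (effActionHT F N (TcanOfRecord F N) (chiFixed29Sel F N ν ε₁) K g k) (domAltOfRecord F N ν K k)) :
    (domAltOfRecord F N ν K (k + 1) ⊆ regSetOfRecord F N K k (betaInputOfRecord F N (TcanOfRecord F N) (chiFixed29Sel F N ν ε₁) K g k) ∧
      HasContTransportOn F N K k (betaInputOfRecord F N (TcanOfRecord F N) (chiFixed29Sel F N ν ε₁) K g k) (domAltOfRecord F N ν K (k + 1))) ∧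
      (∀ V ∈ domAltOfRecord F N ν K (k + 1), 0 < TcanOfRecord F N K k (betaInputOfRecord F N (TcanOfRecord F N) (chiFixed29Sel F N ν ε₁) K g k) V) ∧
      ContinuousOn (effActionHT F N (TcanOfRecord F N) (chiFixed29Sel F N ν ε₁) K g (k + 1)) (domAltOfRecord F N ν K (k + 1)) := by
  have hk1 : k + 1 ≤ (F.P K).m + (F.P K).K := by simp only [T4Continuum.T4Family.P_K]; omega
  have hDk := isOpen_domAltOfRecord (F := F) (N := N) ν K k
  have hDk1 := isOpen_domAltOfRecord (F := F) (N := N) ν K (k + 1)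
  have hregpair := hregSel_of_thm1_of_numerics ν εbg hk g hε1 hα24 hαδ hαL hεreg hε3 hε2 hn1 hn2 hαB hord hlt he hα0 hα3 hα2 hα24' hαL' hε₀ hGFnum h11 hreg8 hA
  -- the by-name suppliers of the step
  have hsolν : ∀ W ∈ domAltOfRecord F N ν K (k + 1), UkExists F N K (k + 1) ν.εreg W := ukExists_εreg_of_h11_of_reg8 ν εbg K h11 hreg8 hlt.le k hk
  have hcrit : ContinuousOn (critCfgSelOfRecord F N ν K k) (domAltOfRecord F N ν K (k + 1)) :=
    hcritSel_domAlt_of_thm1_εbg_of_reg8 ν εbg K hlt he hα0 hα3 hα2 hα24' hαL' h11 hreg8 k hk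
  have hGF : ContinuousOn (gfOfRecord F N K k) (domAltOfRecord F N ν K k) := continuousOn_gfOfRecord_domAlt ν hk1 hε₀ hGFnum
  have hK₀D := localSupportSet_subset_domAlt_of_lt (F := F) (N := N) ν K k (α := α) hord
  have hρcK := hρc_betaInput_chi29Sel_local_of_continuousOn_crit ν ε₁ (TcanOfRecord F N) g hDk1 hDk hK₀D hαδ
    (localSupportSet_subset_loopGuard (F := F) (N := N) K k) hcrit hGF hA
  have hpos : ∀ V ∈ domAltOfRecord F N ν K (k + 1), 0 < TcanOfRecord F N K k (betaInputOfRecord F N (TcanOfRecord F N) (chiFixed29Sel F N ν ε₁) K g k) V := by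
    intro V hV
    have hsol := hsolν V hV
    have havg : (avOfRecord F N K k).avg (critCfgSelOfRecord F N ν K k V) = V := avg_critCfgSelOfRecord hk1 hsol
    obtain ⟨h0, hρpos⟩ := betaInput_chi29Sel_critCfgSel_pos ν K g hε1 (TcanOfRecord F N) hk1 hsol
    have havgD : (avOfRecord F N K k).avg (critCfgSelOfRecord F N ν K k V) ∈ domAltOfRecord F N ν K (k + 1) := by rw [havg]; exact hV
    -- the witness lies in the interior of the local support set, hence in the loop guard (and in `domAlt_k`)
    have hmem := interior_subset (hρK_betaInput_chi29Sel_of_hsolν_of_numerics ν hk (TcanOfRecord F N) g hε1.le hεreg hε3 hε2 hn1 hn2 hαB hsolν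
      (critCfgSelOfRecord F N ν K k V) havgD hρpos.ne')
    have hUα : ∀ c (i : Idx (F.P K)), dist1 (loopHol (critCfgSelOfRecord F N ν K k V) c i) ≤ α :=
      localSupportSet_subset_loopGuard (F := F) (N := N) K k _ hmem
    exact TcanOfRecord_pos_of_localRoute_of_avg_eq hk hα24 hαδ hαL (measurable_betaInput_TcanOfRecord_chi29Sel ν ε₁ K g k)
      (betaInput_chi29Sel_nonneg ν ε₁ (TcanOfRecord F N) K g k) (integrable_betaInput_TcanOfRecord_chi29Sel ν ε₁ K g hk.le) havg hUα
      (hρcK _ hmem havgD fun b _ => by rw [h0 b]; exact hε1.ne) hρpos (hregpair.1 hV)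
  exact ⟨hregpair, hpos, continuousOn_effActionHT_succ_of_subset_regSetOfRecord_of_pos (chiFixed29Sel F N ν ε₁) K g k hregpair.1 hpos⟩

/-- ★★★ **THE TOWER ON THE LOCAL ROUTE FOR THE OFFER: `A_j` IS CONTINUOUS ON `domAlt_j` FOR EVERY `j ≤ K`** — from [B11] Thm 1's two-radii binders and numerics ONLY (induction: base
`continuousOn_effActionHT_zero`, step `hregSel_pos_contA_of_thm1_of_numerics`). [cite: Balaban1987RG1, (0.17)–(0.19) p.255, p.259, (2.9) p.266 and (2.10) p.267; Balaban1985Variational, Thm 1 (8) p.279] -/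
theorem continuousOn_effActionHT_chi29Sel_all_of_thm1_of_numerics
    (hε1 : 0 < ε₁) {α : ℝ} (hα24 : α ≤ 1 / 24) (hαδ : α < deltaSU (Fin N)) (hαL : 157 * α < (((F.P K).L : ℝ) ^ ((F.P K).d - 1))⁻¹)
    (hεreg : 0 < ν.εreg)
    (hε3 : (143 * (((((F.P K).d + 4 : ℕ) : ℝ)) ^ 2 / 4) ^ 2) * ν.εreg ≤ 1 / 3)
    (hε2 : 2 * ν.εreg ≤ 2 * deltaSU (Fin N) / ((((F.P K).d + 4) * (F.P K).L : ℕ) : ℝ) ^ 2)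
    (hn1 : 1640 * (2 * (((((F.P K).d + 2) * (F.P K).L : ℕ) : ℝ) * ε₁) + ((((F.P K).d + 2) * (F.P K).L : ℕ) : ℝ) ^ 2 / 4 * (2 * ν.εreg / ((F.P K).L : ℝ) ^ 2)) *
      (((F.P K).L : ℝ) ^ ((F.P K).d - 1)) ^ 2 ≤ 1)
    (hn2 : 13 * (2 * (((((F.P K).d + 2) * (F.P K).L : ℕ) : ℝ) * ε₁) + ((((F.P K).d + 2) * (F.P K).L : ℕ) : ℝ) ^ 2 / 4 * (2 * ν.εreg / ((F.P K).L : ℝ) ^ 2)) *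
      ((F.P K).L : ℝ) ^ ((F.P K).d - 1) < deltaSU (Fin N))
    (hαB : ((((F.P K).d + 2) * (F.P K).L : ℕ) : ℝ) ^ 2 / 4 *
      (2 * ν.εreg / ((F.P K).L : ℝ) ^ 2 + 4 * max ε₁ (10 * (((((F.P K).d + 2) * (F.P K).L : ℕ) : ℝ) * ε₁) * ((F.P K).L : ℝ) ^ ((F.P K).d - 1))) < α)
    (hord : 2 * ν.εreg / ((F.P K).L : ℝ) ^ 2 + 4 * max ε₁ (10 * (((((F.P K).d + 2) * (F.P K).L : ℕ) : ℝ) * ε₁) * ((F.P K).L : ℝ) ^ ((F.P K).d - 1)) < ν.ε₀)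
    {α₀ : ℝ} (hlt : ν.εreg < εbg) (he : ν.εreg < α₀) (hα0 : 0 < α₀)
    (hα3 : (143 * (((((F.P K).d + 4 : ℕ) : ℝ)) ^ 2 / 4) ^ 2) * α₀ ≤ 1 / 3)
    (hα2 : 2 * α₀ ≤ 2 * deltaSU (Fin N) / ((((F.P K).d + 4) * (F.P K).L : ℕ) : ℝ) ^ 2)
    (hα24' : ((((F.P K).d + 2) * (F.P K).L : ℕ) : ℝ) ^ 2 / 4 * (2 * α₀) ≤ 1 / 24)
    (hαL' : 157 * (((((F.P K).d + 2) * (F.P K).L : ℕ) : ℝ) ^ 2 / 4 * (2 * α₀)) < (((F.P K).L : ℝ) ^ ((F.P K).d - 1))⁻¹)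
    (hε₀ : 0 ≤ ν.ε₀) (hGFnum : ((((F.P K).d * (F.P K).L : ℕ) : ℝ)) ^ 2 / 4 * ν.ε₀ < deltaFed (Fin N))
    (h11 : ∀ j, j ≤ K → ∀ V ∈ domAltOfRecord F N ν K j, UkExists F N K j εbg V ∧ UniqueUkOrbit F N K j εbg V)
    (hreg8 : ∀ j, j ≤ K → ∀ V ∈ domAltOfRecord F N ν K j, Uk F N K j εbg V ∈ bgReg F N K j ν.εreg) :
    ∀ j, j ≤ K → ContinuousOn (effActionHT F N (TcanOfRecord F N) (chiFixed29Sel F N ν ε₁) K g j) (domAltOfRecord F N ν K j)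
  | 0, _ => continuousOn_effActionHT_zero _ _ K g _
  | j + 1, hj => by
    have hjK : j < K := Nat.lt_of_succ_le hj
    have ih := continuousOn_effActionHT_chi29Sel_all_of_thm1_of_numerics hε1 hα24 hαδ hαL hεreg hε3 hε2 hn1 hn2 hαB hord hlt he hα0 hα3 hα2 hα24' hαL'
      hε₀ hGFnum h11 hreg8 j hjK.le
    exact (hregSel_pos_contA_of_thm1_of_numerics ν εbg K g hjK hε1 hα24 hαδ hαL hεreg hε3 hε2 hn1 hn2 hαB hord hlt he hα0 hα3 hα2 hα24' hαL' hε₀ hGFnum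
      h11 hreg8 ih).2.2

/-- ★★★ **… HENCE, FOR EVERY `j < K`: `hreg_j`, the on-domain proviso `HasContTransportOn … ρ_j domAlt_{j+1}`, AND (F3)_j** — ROAD B CLOSED FOR THE OFFER modulo [B11]'s two-radii binders and
numerics. [cite: Balaban1987RG1, p.259, (0.13) p.254, (0.19) p.255 and (2.10) p.267; Balaban1985Variational, Thm 1 (8) p.279] -/
theorem hregSel_pos_all_of_thm1_of_numerics
    (hε1 : 0 < ε₁) {α : ℝ} (hα24 : α ≤ 1 / 24) (hαδ : α < deltaSU (Fin N)) (hαL : 157 * α < (((F.P K).L : ℝ) ^ ((F.P K).d - 1))⁻¹)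
    (hεreg : 0 < ν.εreg)
    (hε3 : (143 * (((((F.P K).d + 4 : ℕ) : ℝ)) ^ 2 / 4) ^ 2) * ν.εreg ≤ 1 / 3)
    (hε2 : 2 * ν.εreg ≤ 2 * deltaSU (Fin N) / ((((F.P K).d + 4) * (F.P K).L : ℕ) : ℝ) ^ 2)
    (hn1 : 1640 * (2 * (((((F.P K).d + 2) * (F.P K).L : ℕ) : ℝ) * ε₁) + ((((F.P K).d + 2) * (F.P K).L : ℕ) : ℝ) ^ 2 / 4 * (2 * ν.εreg / ((F.P K).L : ℝ) ^ 2)) *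
      (((F.P K).L : ℝ) ^ ((F.P K).d - 1)) ^ 2 ≤ 1)
    (hn2 : 13 * (2 * (((((F.P K).d + 2) * (F.P K).L : ℕ) : ℝ) * ε₁) + ((((F.P K).d + 2) * (F.P K).L : ℕ) : ℝ) ^ 2 / 4 * (2 * ν.εreg / ((F.P K).L : ℝ) ^ 2)) *
      ((F.P K).L : ℝ) ^ ((F.P K).d - 1) < deltaSU (Fin N))
    (hαB : ((((F.P K).d + 2) * (F.P K).L : ℕ) : ℝ) ^ 2 / 4 *
      (2 * ν.εreg / ((F.P K).L : ℝ) ^ 2 + 4 * max ε₁ (10 * (((((F.P K).d + 2) * (F.P K).L : ℕ) : ℝ) * ε₁) * ((F.P K).L : ℝ) ^ ((F.P K).d - 1))) < α)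
    (hord : 2 * ν.εreg / ((F.P K).L : ℝ) ^ 2 + 4 * max ε₁ (10 * (((((F.P K).d + 2) * (F.P K).L : ℕ) : ℝ) * ε₁) * ((F.P K).L : ℝ) ^ ((F.P K).d - 1)) < ν.ε₀)
    {α₀ : ℝ} (hlt : ν.εreg < εbg) (he : ν.εreg < α₀) (hα0 : 0 < α₀)
    (hα3 : (143 * (((((F.P K).d + 4 : ℕ) : ℝ)) ^ 2 / 4) ^ 2) * α₀ ≤ 1 / 3)
    (hα2 : 2 * α₀ ≤ 2 * deltaSU (Fin N) / ((((F.P K).d + 4) * (F.P K).L : ℕ) : ℝ) ^ 2)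
    (hα24' : ((((F.P K).d + 2) * (F.P K).L : ℕ) : ℝ) ^ 2 / 4 * (2 * α₀) ≤ 1 / 24)
    (hαL' : 157 * (((((F.P K).d + 2) * (F.P K).L : ℕ) : ℝ) ^ 2 / 4 * (2 * α₀)) < (((F.P K).L : ℝ) ^ ((F.P K).d - 1))⁻¹)
    (hε₀ : 0 ≤ ν.ε₀) (hGFnum : ((((F.P K).d * (F.P K).L : ℕ) : ℝ)) ^ 2 / 4 * ν.ε₀ < deltaFed (Fin N))
    (h11 : ∀ j, j ≤ K → ∀ V ∈ domAltOfRecord F N ν K j, UkExists F N K j εbg V ∧ UniqueUkOrbit F N K j εbg V)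
    (hreg8 : ∀ j, j ≤ K → ∀ V ∈ domAltOfRecord F N ν K j, Uk F N K j εbg V ∈ bgReg F N K j ν.εreg) :
    ∀ j < K, (domAltOfRecord F N ν K (j + 1) ⊆ regSetOfRecord F N K j (betaInputOfRecord F N (TcanOfRecord F N) (chiFixed29Sel F N ν ε₁) K g j) ∧
        HasContTransportOn F N K j (betaInputOfRecord F N (TcanOfRecord F N) (chiFixed29Sel F N ν ε₁) K g j) (domAltOfRecord F N ν K (j + 1))) ∧
      ∀ V ∈ domAltOfRecord F N ν K (j + 1), 0 < TcanOfRecord F N K j (betaInputOfRecord F N (TcanOfRecord F N) (chiFixed29Sel F N ν ε₁) K g j) V := by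
  intro j hj
  have h := hregSel_pos_contA_of_thm1_of_numerics ν εbg K g hj hε1 hα24 hαδ hαL hεreg hε3 hε2 hn1 hn2 hαB hord hlt he hα0 hα3 hα2 hα24' hαL' hε₀ hGFnum h11 hreg8
    (continuousOn_effActionHT_chi29Sel_all_of_thm1_of_numerics ν εbg K g hε1 hα24 hαδ hαL hεreg hε3 hε2 hn1 hn2 hαB hord hlt he hα0 hα3 hα2 hα24' hαL' hε₀ hGFnum
      h11 hreg8 j hj.le)
  exact ⟨h.1, h.2.1⟩

/-- ★★ **EVERY NORMALISATION CONSTANT `𝐍_j = T_jρ_j(1)` IS POSITIVE and (0.19) `T_jρ_j = 𝐍_j·e^{A_{j+1}}` HOLDS ON EVERY DOMAIN, FOR THE OFFER** (`1 ∈ domAlt_{j+1}` when `0 < ν.ε₀`,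
K0e's `one_mem_domAltOfRecord`; lit-balaban r20's `normConst_mul_exp_nextAction`). [cite: Balaban1987RG1, (0.19) p.255–256 and p.259] -/
theorem normConst_chi29Sel_pos_and_eq_exp_of_thm1_of_numerics (hε₀' : 0 < ν.ε₀)
    (hε1 : 0 < ε₁) {α : ℝ} (hα24 : α ≤ 1 / 24) (hαδ : α < deltaSU (Fin N)) (hαL : 157 * α < (((F.P K).L : ℝ) ^ ((F.P K).d - 1))⁻¹)
    (hεreg : 0 < ν.εreg)
    (hε3 : (143 * (((((F.P K).d + 4 : ℕ) : ℝ)) ^ 2 / 4) ^ 2) * ν.εreg ≤ 1 / 3)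
    (hε2 : 2 * ν.εreg ≤ 2 * deltaSU (Fin N) / ((((F.P K).d + 4) * (F.P K).L : ℕ) : ℝ) ^ 2)
    (hn1 : 1640 * (2 * (((((F.P K).d + 2) * (F.P K).L : ℕ) : ℝ) * ε₁) + ((((F.P K).d + 2) * (F.P K).L : ℕ) : ℝ) ^ 2 / 4 * (2 * ν.εreg / ((F.P K).L : ℝ) ^ 2)) *
      (((F.P K).L : ℝ) ^ ((F.P K).d - 1)) ^ 2 ≤ 1)
    (hn2 : 13 * (2 * (((((F.P K).d + 2) * (F.P K).L : ℕ) : ℝ) * ε₁) + ((((F.P K).d + 2) * (F.P K).L : ℕ) : ℝ) ^ 2 / 4 * (2 * ν.εreg / ((F.P K).L : ℝ) ^ 2)) *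
      ((F.P K).L : ℝ) ^ ((F.P K).d - 1) < deltaSU (Fin N))
    (hαB : ((((F.P K).d + 2) * (F.P K).L : ℕ) : ℝ) ^ 2 / 4 *
      (2 * ν.εreg / ((F.P K).L : ℝ) ^ 2 + 4 * max ε₁ (10 * (((((F.P K).d + 2) * (F.P K).L : ℕ) : ℝ) * ε₁) * ((F.P K).L : ℝ) ^ ((F.P K).d - 1))) < α)
    (hord : 2 * ν.εreg / ((F.P K).L : ℝ) ^ 2 + 4 * max ε₁ (10 * (((((F.P K).d + 2) * (F.P K).L : ℕ) : ℝ) * ε₁) * ((F.P K).L : ℝ) ^ ((F.P K).d - 1)) < ν.ε₀)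
    {α₀ : ℝ} (hlt : ν.εreg < εbg) (he : ν.εreg < α₀) (hα0 : 0 < α₀)
    (hα3 : (143 * (((((F.P K).d + 4 : ℕ) : ℝ)) ^ 2 / 4) ^ 2) * α₀ ≤ 1 / 3)
    (hα2 : 2 * α₀ ≤ 2 * deltaSU (Fin N) / ((((F.P K).d + 4) * (F.P K).L : ℕ) : ℝ) ^ 2)
    (hα24' : ((((F.P K).d + 2) * (F.P K).L : ℕ) : ℝ) ^ 2 / 4 * (2 * α₀) ≤ 1 / 24)
    (hαL' : 157 * (((((F.P K).d + 2) * (F.P K).L : ℕ) : ℝ) ^ 2 / 4 * (2 * α₀)) < (((F.P K).L : ℝ) ^ ((F.P K).d - 1))⁻¹)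
    (hGFnum : ((((F.P K).d * (F.P K).L : ℕ) : ℝ)) ^ 2 / 4 * ν.ε₀ < deltaFed (Fin N))
    (h11 : ∀ j, j ≤ K → ∀ V ∈ domAltOfRecord F N ν K j, UkExists F N K j εbg V ∧ UniqueUkOrbit F N K j εbg V)
    (hreg8 : ∀ j, j ≤ K → ∀ V ∈ domAltOfRecord F N ν K j, Uk F N K j εbg V ∈ bgReg F N K j ν.εreg) :
    ∀ j < K, 0 < normConstHT F N (TcanOfRecord F N) (chiFixed29Sel F N ν ε₁) K g j ∧
      ∀ V ∈ domAltOfRecord F N ν K (j + 1),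
        TcanOfRecord F N K j (betaInputOfRecord F N (TcanOfRecord F N) (chiFixed29Sel F N ν ε₁) K g j) V
          = normConstHT F N (TcanOfRecord F N) (chiFixed29Sel F N ν ε₁) K g j *
            Real.exp (effActionHT F N (TcanOfRecord F N) (chiFixed29Sel F N ν ε₁) K g (j + 1) V) := by
  intro j hj
  have hpos := (hregSel_pos_all_of_thm1_of_numerics ν εbg K g hε1 hα24 hαδ hαL hεreg hε3 hε2 hn1 hn2 hαB hord hlt he hα0 hα3 hα2 hα24' hαL' hε₀'.le hGFnum h11 hreg8
    j hj).2
  have hN : 0 < normConstHT F N (TcanOfRecord F N) (chiFixed29Sel F N ν ε₁) K g j := hpos 1 (one_mem_domAltOfRecord ν hε₀' K (j + 1))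
  refine ⟨hN, fun V hV => ?_⟩
  rw [effActionHT_succ]
  exact (normConst_mul_exp_nextAction _ _ _ _ _ hN (hpos V hV)).symm

end Tower

section Inhabited

/-! ## §2 The displayed numerics are jointly inhabited (non-vacuity of the tower's letters; NOT the record's numerics row) -/

/-- Order-topology bookkeeping: a continuous real function vanishing at `0` is eventually `< b` on `𝓝[>] 0` for every `b > 0`. [folklore] -/
theorem eventually_nhdsGT_lt_of_continuous {f : ℝ → ℝ} (hf : Continuous f) (h0 : f 0 = 0) {b : ℝ} (hb : 0 < b) :
    ∀ᶠ t in 𝓝[>] (0 : ℝ), f t < b :=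
  ((hf.tendsto' 0 0 h0).mono_left nhdsWithin_le_nhds).eventually_lt_const hb

/-- Order-topology bookkeeping: a continuous real function vanishing at `0` is eventually `≤ b` on `𝓝[>] 0` for every `b > 0`. [folklore] -/
theorem eventually_nhdsGT_le_of_continuous {f : ℝ → ℝ} (hf : Continuous f) (h0 : f 0 = 0) {b : ℝ} (hb : 0 < b) :
    ∀ᶠ t in 𝓝[>] (0 : ℝ), f t ≤ b :=
  (eventually_nhdsGT_lt_of_continuous hf h0 hb).mono fun _ h => h.le

/-- ★ **THE TOWER'S NUMERICS LETTERS ARE JOINTLY INHABITED** (for every torus family, `N ≥ 1`, `K`, and any integer ∕ profile slots): SOME numerics `ν` (fields `εreg`, `ε₀`), radii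
`εbg`, `α₀`, guard `α` and threshold `ε₁` satisfy all twenty letters of `hregSel_pos_all_of_thm1_of_numerics` ∕ `normConst_chi29Sel_pos_and_eq_exp_of_thm1_of_numerics` at once
(choose `α₀`, `α`, `ε₀` small, then `εreg = ε₁ ↓ 0`).  This is NON-VACUITY of the displayed letters only — whether the RECORD's numerics row meets them is the K0-numerics lane's knit,
not claimed. [cite: Balaban1987RG1, p.259 and (2.9)–(2.10) p.266–267 (the smallness regime); Balaban1985Averaging, Prop. 2 (53) p.26] -/
theorem towerSel_numerics_inhabited (F : T4Family) (N : ℕ) [NeZero N] (K M₁ M₂ r p₀ : ℕ) (A₀ logσ₀ : ℝ) :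
    ∃ (ν : Stage7Numerics) (εbg α₀ α ε₁ : ℝ), ν.M₁ = M₁ ∧ ν.M₂ = M₂ ∧ ν.r = r ∧ ν.p₀ = p₀ ∧ ν.A₀ = A₀ ∧ ν.logσ₀ = logσ₀ ∧
      0 < ν.ε₀ ∧ 0 < ε₁ ∧ α ≤ 1 / 24 ∧ α < deltaSU (Fin N) ∧ 157 * α < (((F.P K).L : ℝ) ^ ((F.P K).d - 1))⁻¹ ∧
      0 < ν.εreg ∧
      (143 * (((((F.P K).d + 4 : ℕ) : ℝ)) ^ 2 / 4) ^ 2) * ν.εreg ≤ 1 / 3 ∧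
      2 * ν.εreg ≤ 2 * deltaSU (Fin N) / ((((F.P K).d + 4) * (F.P K).L : ℕ) : ℝ) ^ 2 ∧
      1640 * (2 * (((((F.P K).d + 2) * (F.P K).L : ℕ) : ℝ) * ε₁) + ((((F.P K).d + 2) * (F.P K).L : ℕ) : ℝ) ^ 2 / 4 * (2 * ν.εreg / ((F.P K).L : ℝ) ^ 2)) *
        (((F.P K).L : ℝ) ^ ((F.P K).d - 1)) ^ 2 ≤ 1 ∧
      13 * (2 * (((((F.P K).d + 2) * (F.P K).L : ℕ) : ℝ) * ε₁) + ((((F.P K).d + 2) * (F.P K).L : ℕ) : ℝ) ^ 2 / 4 * (2 * ν.εreg / ((F.P K).L : ℝ) ^ 2)) *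
        ((F.P K).L : ℝ) ^ ((F.P K).d - 1) < deltaSU (Fin N) ∧
      ((((F.P K).d + 2) * (F.P K).L : ℕ) : ℝ) ^ 2 / 4 *
        (2 * ν.εreg / ((F.P K).L : ℝ) ^ 2 + 4 * max ε₁ (10 * (((((F.P K).d + 2) * (F.P K).L : ℕ) : ℝ) * ε₁) * ((F.P K).L : ℝ) ^ ((F.P K).d - 1))) < α ∧
      2 * ν.εreg / ((F.P K).L : ℝ) ^ 2 + 4 * max ε₁ (10 * (((((F.P K).d + 2) * (F.P K).L : ℕ) : ℝ) * ε₁) * ((F.P K).L : ℝ) ^ ((F.P K).d - 1)) < ν.ε₀ ∧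
      ν.εreg < εbg ∧ ν.εreg < α₀ ∧ 0 < α₀ ∧
      (143 * (((((F.P K).d + 4 : ℕ) : ℝ)) ^ 2 / 4) ^ 2) * α₀ ≤ 1 / 3 ∧
      2 * α₀ ≤ 2 * deltaSU (Fin N) / ((((F.P K).d + 4) * (F.P K).L : ℕ) : ℝ) ^ 2 ∧
      ((((F.P K).d + 2) * (F.P K).L : ℕ) : ℝ) ^ 2 / 4 * (2 * α₀) ≤ 1 / 24 ∧
      157 * (((((F.P K).d + 2) * (F.P K).L : ℕ) : ℝ) ^ 2 / 4 * (2 * α₀)) < (((F.P K).L : ℝ) ^ ((F.P K).d - 1))⁻¹ ∧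
      ((((F.P K).d * (F.P K).L : ℕ) : ℝ)) ^ 2 / 4 * ν.ε₀ < deltaFed (Fin N) := by
  have hδ : 0 < deltaSU (Fin N) := deltaSU_pos
  have hδF : 0 < deltaFed (Fin N) := deltaFed_pos
  have hL : (0 : ℝ) < (F.P K).L := by exact_mod_cast (F.P K).L_pos
  have hΛ : 0 < (((F.P K).L : ℝ) ^ ((F.P K).d - 1))⁻¹ := inv_pos.2 (pow_pos hL _)
  have hℓ4 : (0 : ℝ) < ((((F.P K).d + 4) * (F.P K).L : ℕ) : ℝ) := by exact_mod_cast Nat.mul_pos (by omega) (F.P K).L_pos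
  have hq : 0 < 2 * deltaSU (Fin N) / ((((F.P K).d + 4) * (F.P K).L : ℕ) : ℝ) ^ 2 := div_pos (mul_pos two_pos hδ) (pow_pos hℓ4 2)
  have h0 : ∀ᶠ t in 𝓝[>] (0 : ℝ), 0 < t := self_mem_nhdsWithin
  -- the background radius `α₀` (= `εbg`)
  have Hα₀ := h0.and <|
    (eventually_nhdsGT_le_of_continuous (f := fun s : ℝ => (143 * (((((F.P K).d + 4 : ℕ) : ℝ)) ^ 2 / 4) ^ 2) * s) (by fun_prop) (by simp)
      (by norm_num : (0 : ℝ) < 1 / 3)).and <|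
    (eventually_nhdsGT_le_of_continuous (f := fun s : ℝ => 2 * s) (by fun_prop) (by simp) hq).and <|
    (eventually_nhdsGT_le_of_continuous (f := fun s : ℝ => ((((F.P K).d + 2) * (F.P K).L : ℕ) : ℝ) ^ 2 / 4 * (2 * s)) (by fun_prop) (by simp)
      (by norm_num : (0 : ℝ) < 1 / 24)).and <|
    eventually_nhdsGT_lt_of_continuous (f := fun s : ℝ => 157 * (((((F.P K).d + 2) * (F.P K).L : ℕ) : ℝ) ^ 2 / 4 * (2 * s))) (by fun_prop) (by simp) hΛ
  obtain ⟨α₀, hα0, hα3, hα2, hα24', hαL'⟩ := Hα₀.exists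
  -- the loop guard `α`
  have Hα := h0.and <|
    (eventually_nhdsGT_le_of_continuous (f := fun s : ℝ => s) continuous_id rfl (by norm_num : (0 : ℝ) < 1 / 24)).and <|
    (eventually_nhdsGT_lt_of_continuous (f := fun s : ℝ => s) continuous_id rfl hδ).and <|
    eventually_nhdsGT_lt_of_continuous (f := fun s : ℝ => 157 * s) (by fun_prop) (by simp) hΛ
  obtain ⟨α, hαpos, hα24, hαδ, hαL⟩ := Hα.exists
  -- the small-field threshold `ε₀`
  have Hε₀ := h0.and <|
    eventually_nhdsGT_lt_of_continuous (f := fun s : ℝ => ((((F.P K).d * (F.P K).L : ℕ) : ℝ)) ^ 2 / 4 * s) (by fun_prop) (by simp) hδF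
  obtain ⟨ε₀, hε₀, hGFnum⟩ := Hε₀.exists
  -- the regularity threshold `εreg = ε₁ = t ↓ 0`
  have hmax : Continuous fun t : ℝ => max t (10 * (((((F.P K).d + 2) * (F.P K).L : ℕ) : ℝ) * t) * ((F.P K).L : ℝ) ^ ((F.P K).d - 1)) :=
    continuous_id.max (by fun_prop)
  have hQ : Continuous fun t : ℝ => 2 * t / ((F.P K).L : ℝ) ^ 2 +
      4 * max t (10 * (((((F.P K).d + 2) * (F.P K).L : ℕ) : ℝ) * t) * ((F.P K).L : ℝ) ^ ((F.P K).d - 1)) :=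
    ((continuous_const.mul continuous_id).div_const _).add (continuous_const.mul hmax)
  have Ht := h0.and <|
    (eventually_nhdsGT_le_of_continuous (f := fun t : ℝ => (143 * (((((F.P K).d + 4 : ℕ) : ℝ)) ^ 2 / 4) ^ 2) * t) (by fun_prop) (by simp)
      (by norm_num : (0 : ℝ) < 1 / 3)).and <|
    (eventually_nhdsGT_le_of_continuous (f := fun t : ℝ => 2 * t) (by fun_prop) (by simp) hq).and <|
    (eventually_nhdsGT_le_of_continuous (f := fun t : ℝ =>
      1640 * (2 * (((((F.P K).d + 2) * (F.P K).L : ℕ) : ℝ) * t) + ((((F.P K).d + 2) * (F.P K).L : ℕ) : ℝ) ^ 2 / 4 * (2 * t / ((F.P K).L : ℝ) ^ 2)) *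
        (((F.P K).L : ℝ) ^ ((F.P K).d - 1)) ^ 2) (by fun_prop) (by simp) one_pos).and <|
    (eventually_nhdsGT_lt_of_continuous (f := fun t : ℝ =>
      13 * (2 * (((((F.P K).d + 2) * (F.P K).L : ℕ) : ℝ) * t) + ((((F.P K).d + 2) * (F.P K).L : ℕ) : ℝ) ^ 2 / 4 * (2 * t / ((F.P K).L : ℝ) ^ 2)) *
        ((F.P K).L : ℝ) ^ ((F.P K).d - 1)) (by fun_prop) (by simp) hδ).and <|
    (eventually_nhdsGT_lt_of_continuous (f := fun t : ℝ => ((((F.P K).d + 2) * (F.P K).L : ℕ) : ℝ) ^ 2 / 4 *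
        (2 * t / ((F.P K).L : ℝ) ^ 2 + 4 * max t (10 * (((((F.P K).d + 2) * (F.P K).L : ℕ) : ℝ) * t) * ((F.P K).L : ℝ) ^ ((F.P K).d - 1))))
      (continuous_const.mul hQ) (by simp) hαpos).and <|
    (eventually_nhdsGT_lt_of_continuous hQ (by simp) hε₀).and <|
    eventually_nhdsGT_lt_of_continuous (f := fun t : ℝ => t) continuous_id rfl hα0
  obtain ⟨t, ht0, hε3, hε2, hn1, hn2, hαB, hord, hlt⟩ := Ht.exists
  exact ⟨⟨M₁, M₂, r, p₀, A₀, logσ₀, t, ε₀⟩, α₀, α₀, α, t, rfl, rfl, rfl, rfl, rfl, rfl, hε₀, ht0, hα24, hαδ, hαL, ht0, hε3, hε2, hn1, hn2, hαB, hord,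
    hlt, hlt, hα0, hα3, hα2, hα24', hαL', hGFnum⟩

/-- ★★ **… HENCE THE TOWER IS NOT VACUOUS IN ITS NUMERICS**: for every torus family, `N ≥ 1`, `K`, history `g` (and any integer ∕ profile slots) there ARE numerics `ν`, radii `εbg`
and a threshold `ε₁` for which the ONLY displayed inputs left in `hregSel_pos_all_of_thm1_of_numerics` are [B11] Thm 1's two-radii binders `h11` ∕ `hreg8` on the domains.
[cite: Balaban1987RG1, p.259, (0.19) p.255 and (2.10) p.267; Balaban1985Variational, Thm 1 (8) p.279] -/
theorem exists_numerics_hregSel_pos_all_of_thm1 (F : T4Family) (N : ℕ) [NeZero N] (K M₁ M₂ r p₀ : ℕ) (A₀ logσ₀ : ℝ) (g : ℕ → ℝ) :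
    ∃ (ν : Stage7Numerics) (εbg ε₁ : ℝ), ν.M₁ = M₁ ∧ ν.M₂ = M₂ ∧ ν.r = r ∧ ν.p₀ = p₀ ∧ ν.A₀ = A₀ ∧ ν.logσ₀ = logσ₀ ∧
      0 < ν.εreg ∧ ν.εreg < εbg ∧ 0 < ν.ε₀ ∧ 0 < ε₁ ∧
      ((∀ j, j ≤ K → ∀ V ∈ domAltOfRecord F N ν K j, UkExists F N K j εbg V ∧ UniqueUkOrbit F N K j εbg V) →
        (∀ j, j ≤ K → ∀ V ∈ domAltOfRecord F N ν K j, Uk F N K j εbg V ∈ bgReg F N K j ν.εreg) →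
          ∀ j < K, (domAltOfRecord F N ν K (j + 1) ⊆ regSetOfRecord F N K j (betaInputOfRecord F N (TcanOfRecord F N) (chiFixed29Sel F N ν ε₁) K g j) ∧
              HasContTransportOn F N K j (betaInputOfRecord F N (TcanOfRecord F N) (chiFixed29Sel F N ν ε₁) K g j) (domAltOfRecord F N ν K (j + 1))) ∧
            ∀ V ∈ domAltOfRecord F N ν K (j + 1), 0 < TcanOfRecord F N K j (betaInputOfRecord F N (TcanOfRecord F N) (chiFixed29Sel F N ν ε₁) K g j) V) := by
  obtain ⟨ν, εbg, α₀, α, ε₁, h1, h2, h3, h4, h5, h6, hε₀, hε1, hα24, hαδ, hαL, hεreg, hε3, hε2, hn1, hn2, hαB, hord, hlt, he, hα0, hα3, hα2, hα24', hαL', hGFnum⟩ :=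
    towerSel_numerics_inhabited F N K M₁ M₂ r p₀ A₀ logσ₀
  exact ⟨ν, εbg, ε₁, h1, h2, h3, h4, h5, h6, hεreg, hlt, hε₀, hε1, fun h11 hreg8 =>
    hregSel_pos_all_of_thm1_of_numerics ν εbg K g hε1 hα24 hαδ hαL hεreg hε3 hε2 hn1 hn2 hαB hord hlt he hα0 hα3 hα2 hα24' hαL' hε₀.le hGFnum h11 hreg8⟩

end Inhabited

section AlphaFree

variable (ν : Stage7Numerics) (εbg : ℝ) (K : ℕ) (g : ℕ → ℝ) {ε₁ : ℝ}

/-- ★★ **α-FREE EDITION** (road A′'s currency, dag-n09-w4 g6): the loop-guard radius `α` is not a letter — at `α := (((d+2)L)²∕4)·ε₀` the four guard letters `hα24 hαδ hαL hαB` of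
`hregSel_pos_all_of_thm1_of_numerics` are theorems of the three `ε₀`-lines `h24 h64 hL` and of the strict (hord) (`(ℓ²∕4)·Q < (ℓ²∕4)·ε₀`), so road B for the OFFER displays [B11]'s
two-radii binders + numerics in `(εreg, ε₁, ε₀, εbg, α₀; d, L, N)` only. [cite: Balaban1987RG1, p.259, (0.19) p.255, (2.9)–(2.10) p.266–267; Balaban1985Variational, Thm 1 (8) p.279] -/
theorem hregSel_pos_all_of_thm1_of_numerics_alphaFree
    (hε1 : 0 < ε₁) (hεreg : 0 < ν.εreg)
    (hε3 : (143 * (((((F.P K).d + 4 : ℕ) : ℝ)) ^ 2 / 4) ^ 2) * ν.εreg ≤ 1 / 3)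
    (hε2 : 2 * ν.εreg ≤ 2 * deltaSU (Fin N) / ((((F.P K).d + 4) * (F.P K).L : ℕ) : ℝ) ^ 2)
    (hn1 : 1640 * (2 * (((((F.P K).d + 2) * (F.P K).L : ℕ) : ℝ) * ε₁) + ((((F.P K).d + 2) * (F.P K).L : ℕ) : ℝ) ^ 2 / 4 * (2 * ν.εreg / ((F.P K).L : ℝ) ^ 2)) *
      (((F.P K).L : ℝ) ^ ((F.P K).d - 1)) ^ 2 ≤ 1)
    (hn2 : 13 * (2 * (((((F.P K).d + 2) * (F.P K).L : ℕ) : ℝ) * ε₁) + ((((F.P K).d + 2) * (F.P K).L : ℕ) : ℝ) ^ 2 / 4 * (2 * ν.εreg / ((F.P K).L : ℝ) ^ 2)) *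
      ((F.P K).L : ℝ) ^ ((F.P K).d - 1) < deltaSU (Fin N))
    (hord : 2 * ν.εreg / ((F.P K).L : ℝ) ^ 2 + 4 * max ε₁ (10 * (((((F.P K).d + 2) * (F.P K).L : ℕ) : ℝ) * ε₁) * ((F.P K).L : ℝ) ^ ((F.P K).d - 1)) < ν.ε₀)
    (hε₀ : 0 ≤ ν.ε₀)
    (h24 : ((((F.P K).d + 2) * (F.P K).L : ℕ) : ℝ) ^ 2 / 4 * ν.ε₀ < 1 / 24)
    (h64 : 64 * (((((F.P K).d + 2) * (F.P K).L : ℕ) : ℝ) ^ 2 / 4 * ν.ε₀) < deltaSU (Fin N))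
    (hL : 157 * (((((F.P K).d + 2) * (F.P K).L : ℕ) : ℝ) ^ 2 / 4 * ν.ε₀) < ((((F.P K).L : ℝ)) ^ ((F.P K).d - 1))⁻¹)
    (hGFnum : ((((F.P K).d * (F.P K).L : ℕ) : ℝ)) ^ 2 / 4 * ν.ε₀ < deltaFed (Fin N))
    {α₀ : ℝ} (hlt : ν.εreg < εbg) (he : ν.εreg < α₀) (hα0 : 0 < α₀)
    (hα3 : (143 * (((((F.P K).d + 4 : ℕ) : ℝ)) ^ 2 / 4) ^ 2) * α₀ ≤ 1 / 3)
    (hα2 : 2 * α₀ ≤ 2 * deltaSU (Fin N) / ((((F.P K).d + 4) * (F.P K).L : ℕ) : ℝ) ^ 2)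
    (hα24' : ((((F.P K).d + 2) * (F.P K).L : ℕ) : ℝ) ^ 2 / 4 * (2 * α₀) ≤ 1 / 24)
    (hαL' : 157 * (((((F.P K).d + 2) * (F.P K).L : ℕ) : ℝ) ^ 2 / 4 * (2 * α₀)) < (((F.P K).L : ℝ) ^ ((F.P K).d - 1))⁻¹)
    (h11 : ∀ j, j ≤ K → ∀ V ∈ domAltOfRecord F N ν K j, UkExists F N K j εbg V ∧ UniqueUkOrbit F N K j εbg V)
    (hreg8 : ∀ j, j ≤ K → ∀ V ∈ domAltOfRecord F N ν K j, Uk F N K j εbg V ∈ bgReg F N K j ν.εreg) :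
    ∀ j < K, (domAltOfRecord F N ν K (j + 1) ⊆ regSetOfRecord F N K j (betaInputOfRecord F N (TcanOfRecord F N) (chiFixed29Sel F N ν ε₁) K g j) ∧
        HasContTransportOn F N K j (betaInputOfRecord F N (TcanOfRecord F N) (chiFixed29Sel F N ν ε₁) K g j) (domAltOfRecord F N ν K (j + 1))) ∧
      ∀ V ∈ domAltOfRecord F N ν K (j + 1), 0 < TcanOfRecord F N K j (betaInputOfRecord F N (TcanOfRecord F N) (chiFixed29Sel F N ν ε₁) K g j) V := by
  have hℓ : (0 : ℝ) < ((((F.P K).d + 2) * (F.P K).L : ℕ) : ℝ) ^ 2 / 4 :=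
    div_pos (pow_pos (by exact_mod_cast Nat.mul_pos (by omega) (F.P K).L_pos) 2) four_pos
  have hm0 : 0 ≤ ((((F.P K).d + 2) * (F.P K).L : ℕ) : ℝ) ^ 2 / 4 * ν.ε₀ := mul_nonneg hℓ.le hε₀
  exact hregSel_pos_all_of_thm1_of_numerics ν εbg K g hε1 (α := ((((F.P K).d + 2) * (F.P K).L : ℕ) : ℝ) ^ 2 / 4 * ν.ε₀) h24.le (by linarith) hL hεreg
    hε3 hε2 hn1 hn2 (mul_lt_mul_of_pos_left hord hℓ) hord hlt he hα0 hα3 hα2 hα24' hαL' hε₀ hGFnum h11 hreg8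

end AlphaFree

end Summit.QuantumFields.YangMills.BalabanUVNodes.N09RegularityTowerSelOfThm1OfNumerics

end
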